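import Summits.RiemannHypothesis.RiemannHypothesis.Theorems.WeilWindowFlowWindowLipschitzStubLocalizedCut
import Summits.RiemannHypothesis.RiemannHypothesis.Theorems.OddSectorOddOneSignedWindowsOddFormDomainPos
import Summits.RiemannHypothesis.RiemannHypothesis.Theorems.OddSectorWindowLipschitzEulerLagrangeAll
import HarnessLib

/-!
# Odd-sector window-Lipschitz, PART 4: the localised-cut (IMS) inequality at an odd-sector
# ground state, for EVEN cutoffs (pub-rhpf, transport-1, leaf G1.22 'TRANSPORT'; RH-free; def-free)

**mechanism/rigidity campaign; no RH claims.**  Companion text: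
`run/shared/lean/pub/pub-rhpf/pub-rhpf-transport-1/TRANSPORT.md` §23 (odd-sector window-Lipschitz).

Odd-sector twin of `WeilWindowFlowWindowLipschitz.stub_localizedCut` (route WeilWindowFlow, line
`cut-dont-squeeze`, Stub D), with the three hypotheses of the even stub discharged by LANDED odd-sector
facts: (C1_od) `OddSector.odd_formDomainPos_ae` — `(M_a + ε_od(a))‖f‖² ≤ P(f) + 𝓔_a(f)` for
finite-energy `f` living on the window and ODD a.e.; (C2) `oddGroundState_finiteEnergy'`; (EL, all
directions) `oddGroundState_eulerLagrange_all` (PART 1).  The one new hypothesis is that the cutoff `χ`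
be EVEN, so that `χu` is a.e. odd and (C1_od) applies to it at the smaller window; the cutoffs used
downstream (`χ(x) = clamp((a − h − |x|)/h)`) are even.

`oddLocalizedCut`: for `0 < b ≤ a`, `IsWeilOddGroundState a u`, `χ` even, `K`-Lipschitz, `[0,1]`-valued,
`= 0` on `|x| ≥ b`:
`(ε_od(b) − ε_od(a)) ‖χu‖² ≤ ArchComm + PrimeComm + 2|∫θu ch|² + 2|∫u ch||∫θ²u ch| + 2|∫u sh||∫θ²u sh|`.

Proof: VERBATIM the even file (its `u`-independent toolkit `…StubLocalizedCutAux/Aux2` is imported).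

Labels: PROVED tree material only (RH-free); no hypothesis is an open item.  Nothing here is a step toward RH.

References: E. Bombieri, Rend. Mat. Acc. Lincei (9) 11 (2000), §4 Lemma 1 / (4.2); H. Cycon,
R. Froese, W. Kirsch, B. Simon, *Schrödinger Operators*, Springer (1987), Thm 3.2 (IMS localisation).
-/

set_option linter.dupNamespace false  -- D-0017 nested layout: `RiemannHypothesis.RiemannHypothesis`

noncomputable section

open MeasureTheory Set Filter
open scoped Topology ENNReal NNReal ComplexConjugate ArithmeticFunction.vonMangoldt

namespace Summit.RiemannHypothesis.RiemannHypothesis.Theorems.OddSectorWindowLipschitz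

open Literature.NumberTheory.LFunctions Literature.NumberTheory.LFunctions.ConnesVanSuijlekom
open Summit.RiemannHypothesis.RiemannHypothesis.Theorems.WeilWindowFlowWindowLipschitz

/-- **The localised-cut inequality at an odd-sector ground state** (odd twin of Stub D
`WeilWindowFlowWindowLipschitz.stub_localizedCut`, line `cut-dont-squeeze`; hypotheses (C1), (C2), (EL)
of the even stub DISCHARGED by the landed odd-sector spine `OddSector.odd_formDomainPos_ae`,
`oddGroundState_finiteEnergy'`, `oddGroundState_eulerLagrange_all`).  For `0 < b ≤ a`, an odd-sector
ground state `u` of the window `a` and an EVEN `K`-Lipschitz cutoff `χ` with values in `[0, 1]` vanishing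
on `|x| ≥ b` (evenness makes `χu` a.e. odd, so the odd-sector form bound (C1_od) applies to it at the
window `b`):
`(ε_od(b) − ε_od(a)) ‖χu‖² ≤ ArchComm + PrimeComm + 2|∫θu ch|² + 2|∫u ch||∫θ²u ch| + 2|∫u sh||∫θ²u sh|`
(`θ = 1 − χ`, `ch = cosh(t/2)`, `sh = sinh(t/2)`,
`ArchComm = ∫₀^∞ ρ(t) ∫ (χ(x+t) − χ x)² |u(x+t)||u x|`,
`PrimeComm = Σ_{log n < 2a} Λ(n) n^{-1/2} ∫ (χ(x+log n) − χ x)² |u(x+log n)||u x|`).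
Proof: verbatim the even stub (bounded Lipschitz multipliers preserve the finite-energy class; (C1_od)
at the window `b` for `χu` and the window change; expansion `χu = u − θu` with (EL) for `w = θu`, `θ²u`
— these directions are a.e. odd too, but (EL, all directions) does not need it — and the pointwise IMS
identity).  [cite: Bombieri2000Weil, §4 Lemma 1 / (4.2)] -/
theorem oddLocalizedCut :
    ∀ (a b : ℝ) (K : ℝ≥0) (u : ℝ → ℂ) (χ : ℝ → ℝ), 0 < b → b ≤ a → IsWeilOddGroundState a u →
        LipschitzWith K χ → (∀ x, 0 ≤ χ x ∧ χ x ≤ 1) → (∀ x, b ≤ |x| → χ x = 0) →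
        (∀ x, χ (-x) = χ x) →
        (weilOddGroundEnergy b - weilOddGroundEnergy a) * ∫ x, ‖(χ x : ℂ) * u x‖ ^ 2 ≤
          (∫ t in Ioi (0 : ℝ), weilArchDensity t *
              ∫ x, (χ (x + t) - χ x) ^ 2 * (‖u (x + t)‖ * ‖u x‖)) +
          (∑ n ∈ weilPrimeIndex a, (ArithmeticFunction.vonMangoldt n : ℝ) / Real.sqrt n *
              ∫ x, (χ (x + Real.log n) - χ x) ^ 2 * (‖u (x + Real.log n)‖ * ‖u x‖)) +
          2 * ‖∫ t, ((1 - χ t : ℝ) : ℂ) * u t * (Real.cosh (t / 2) : ℂ)‖ ^ 2 +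
          2 * ‖∫ t, u t * (Real.cosh (t / 2) : ℂ)‖ *
              ‖∫ t, (((1 - χ t) ^ 2 : ℝ) : ℂ) * u t * (Real.cosh (t / 2) : ℂ)‖ +
          2 * ‖∫ t, u t * (Real.sinh (t / 2) : ℂ)‖ *
              ‖∫ t, (((1 - χ t) ^ 2 : ℝ) : ℂ) * u t * (Real.sinh (t / 2) : ℂ)‖ := by
  intro a b K u χ hb hba hgs hχ h01 hχb hχe
  have hC2 := oddGroundState_finiteEnergy'
  have hEL := oddGroundState_eulerLagrange_all
  -- basic data on `u` and the multipliers `χ`, `θ = 1 − χ`, `θ²`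
  have hu : MemLp u 2 := hgs.memLp
  have hχc : Continuous χ := hχ.continuous
  have hK : (0 : ℝ) ≤ K := K.2
  have hχL : ∀ x y, |χ x - χ y| ≤ K * |x - y| := fun x y ↦ by
    have h := hχ.dist_le_mul x y
    rwa [Real.dist_eq, Real.dist_eq] at h
  have hθL : ∀ x y, |(1 - χ x) - (1 - χ y)| ≤ K * |x - y| := fun x y ↦ by
    rw [show (1 - χ x) - (1 - χ y) = χ y - χ x by ring, abs_sub_comm]
    exact hχL x y
  have hθ2L : ∀ x y, |(1 - χ x) ^ 2 - (1 - χ y) ^ 2| ≤ 2 * K * |x - y| := fun x y ↦ by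
    rw [show (1 - χ x) ^ 2 - (1 - χ y) ^ 2 = ((1 - χ x) + (1 - χ y)) * ((1 - χ x) - (1 - χ y))
      by ring, abs_mul]
    have hs : |(1 - χ x) + (1 - χ y)| ≤ 2 := by
      rw [abs_le]
      constructor <;> linarith [(h01 x).1, (h01 x).2, (h01 y).1, (h01 y).2]
    calc |(1 - χ x) + (1 - χ y)| * |(1 - χ x) - (1 - χ y)| ≤ 2 * (K * |x - y|) :=
          mul_le_mul hs (hθL x y) (abs_nonneg _) zero_le_two
      _ = 2 * K * |x - y| := by ring
  have h01θ : ∀ x, 0 ≤ 1 - χ x ∧ 1 - χ x ≤ 1 := fun x ↦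
    ⟨by linarith [(h01 x).2], by linarith [(h01 x).1]⟩
  have h01θ2 : ∀ x, 0 ≤ (1 - χ x) ^ 2 ∧ (1 - χ x) ^ 2 ≤ 1 := fun x ↦
    ⟨sq_nonneg _, by nlinarith [(h01θ x).1, (h01θ x).2]⟩
  -- `L²` membership of `χu`, `θu`, `θ²u`
  have hχm : MemLp (fun x ↦ (χ x : ℂ) * u x) 2 :=
    stub_localizedCut_memLp_mul hu hχc fun x ↦ abs_le.2 ⟨by linarith [(h01 x).1], (h01 x).2⟩
  have hθm : MemLp (fun x ↦ ((1 - χ x : ℝ) : ℂ) * u x) 2 :=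
    stub_localizedCut_memLp_mul hu (by fun_prop) fun x ↦
      abs_le.2 ⟨by linarith [(h01θ x).1], (h01θ x).2⟩
  have hθ2m : MemLp (fun x ↦ (((1 - χ x) ^ 2 : ℝ) : ℂ) * u x) 2 :=
    stub_localizedCut_memLp_mul hu (by fun_prop) fun x ↦
      abs_le.2 ⟨by linarith [(h01θ2 x).1], (h01θ2 x).2⟩
  -- finite energies (C2 for `u`; bounded Lipschitz multipliers preserve finite energy)
  obtain ⟨hfinU, F7⟩ := hC2 a u hgs
  have hfinχ : IntegrableOn
      (fun t ↦ weilArchDensity t * weilIncrement (fun x ↦ (χ x : ℂ) * u x) t) (Ioi 0) :=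
    stub_localizedCut_finiteEnergy_mul hu hχc h01 hK hχL hfinU
  have hfinθ : IntegrableOn
      (fun t ↦ weilArchDensity t * weilIncrement (fun x ↦ ((1 - χ x : ℝ) : ℂ) * u x) t) (Ioi 0) :=
    stub_localizedCut_finiteEnergy_mul (m := fun x ↦ 1 - χ x) hu (by fun_prop) h01θ hK hθL hfinU
  have hfinθ2 : IntegrableOn
      (fun t ↦ weilArchDensity t * weilIncrement (fun x ↦ (((1 - χ x) ^ 2 : ℝ) : ℂ) * u x) t)
      (Ioi 0) :=
    stub_localizedCut_finiteEnergy_mul (m := fun x ↦ (1 - χ x) ^ 2) hu (by fun_prop) h01θ2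
      (by positivity) hθ2L hfinU
  -- supports
  have hθvan : ∀ᵐ x : ℝ, x ∉ Icc (-a) a → ((1 - χ x : ℝ) : ℂ) * u x = 0 :=
    hgs.ae_eq_zero_of_notMem.mono fun x hx hxa ↦ by rw [hx hxa, mul_zero]
  have hθ2van : ∀ᵐ x : ℝ, x ∉ Icc (-a) a → (((1 - χ x) ^ 2 : ℝ) : ℂ) * u x = 0 :=
    hgs.ae_eq_zero_of_notMem.mono fun x hx hxa ↦ by rw [hx hxa, mul_zero]
  have hχsupp : ∀ x, b ≤ |x| → (χ x : ℂ) * u x = 0 := fun x hx ↦ by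
    rw [hχb x hx, Complex.ofReal_zero, zero_mul]
  have hχvan : ∀ᵐ x : ℝ, x ∉ Icc (-b) b → (χ x : ℂ) * u x = 0 :=
    ae_of_all _ fun x hx ↦ hχsupp x (by
      by_contra h
      have h' := abs_lt.1 (not_le.1 h)
      exact hx ⟨h'.1.le, h'.2.le⟩)
  -- (C1) at the window `b` and the window change
  have hχodd : ∀ᵐ x : ℝ, (χ (-x) : ℂ) * u (-x) = -((χ x : ℂ) * u x) := by
    filter_upwards [hgs.ae_neg] with x hx
    rw [hχe, hx, mul_neg]
  have F1 := OddSector.odd_formDomainPos_ae hb hχm hχvan hχodd hfinχ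
  have F2 := stub_localizedCut_energy_window (a := a) hχm hba hχsupp
  beta_reduce at F1 F2
  -- the Euler–Lagrange identities for `w = θu` and `w = θ²u`, real parts
  have F6 := congrArg Complex.re
    (hEL a u hgs (fun x ↦ ((1 - χ x : ℝ) : ℂ) * u x) hθm hθvan hfinθ)
  have F8 := congrArg Complex.re
    (hEL a u hgs (fun x ↦ (((1 - χ x) ^ 2 : ℝ) : ℂ) * u x) hθ2m hθ2van hfinθ2)
  simp only [Complex.sub_re, Complex.add_re, Complex.re_sum, Complex.re_ofReal_mul] at F6 F8
  -- `⟨u, θ²u⟩ = ‖θu‖²`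
  have hinner : (∫ x, u x * conj ((((1 - χ x) ^ 2 : ℝ) : ℂ) * u x)).re =
      ∫ x, ‖((1 - χ x : ℝ) : ℂ) * u x‖ ^ 2 := by
    have hI : Integrable fun x ↦ u x * conj ((((1 - χ x) ^ 2 : ℝ) : ℂ) * u x) :=
      hu.integrable_mul (memLp_conj hθ2m)
    rw [← stub_localizedCut_integral_re hI]
    refine integral_congr_ae (ae_of_all _ fun x ↦ ?_)
    beta_reduce
    rw [norm_mul, mul_pow, Complex.norm_real, Real.norm_eq_abs, sq_abs, ← Complex.normSq_eq_norm_sq,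
      Complex.normSq_apply]
    simp only [map_mul, Complex.conj_ofReal, Complex.mul_re, Complex.mul_im, Complex.ofReal_re,
      Complex.ofReal_im, Complex.conj_re, Complex.conj_im]
    ring
  -- integrability of the pole vectors
  have huc : Integrable fun x ↦ u x * (Real.cosh (x / 2) : ℂ) :=
    hgs.integrable_mul_continuous (by fun_prop)
  have hus : Integrable fun x ↦ u x * (Real.sinh (x / 2) : ℂ) :=
    hgs.integrable_mul_continuous (by fun_prop)
  have hθc' : Integrable fun x ↦ ((1 - χ x : ℝ) : ℂ) * u x * (Real.cosh (x / 2) : ℂ) :=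
    (hgs.integrable_mul_continuous (w := fun x ↦ ((1 - χ x : ℝ) : ℂ) * (Real.cosh (x / 2) : ℂ))
      (by fun_prop)).congr (ae_of_all _ fun x ↦ by ring)
  have hθs' : Integrable fun x ↦ ((1 - χ x : ℝ) : ℂ) * u x * (Real.sinh (x / 2) : ℂ) :=
    (hgs.integrable_mul_continuous (w := fun x ↦ ((1 - χ x : ℝ) : ℂ) * (Real.sinh (x / 2) : ℂ))
      (by fun_prop)).congr (ae_of_all _ fun x ↦ by ring)
  -- expansions of `χu = u − θu`
  have hχθ : (fun x ↦ (χ x : ℂ) * u x) = fun x ↦ u x - ((1 - χ x : ℝ) : ℂ) * u x := by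
    funext x
    push_cast
    ring
  have F3 := stub_localizedCut_weilPoleForm_sub huc hθc' hus hθs'
  have F4 := stub_localizedCut_weilDirichletEnergy_sub a hu hθm hfinU hfinθ
  have F5 := stub_localizedCut_integral_norm_sq_sub hu hθm
  beta_reduce at F3 F4 F5
  rw [← hχθ] at F3 F4
  have F5' := congrArg (fun f : ℝ → ℂ ↦ ∫ x, ‖f x‖ ^ 2) hχθ
  beta_reduce at F5'
  rw [F5] at F5'
  have F5m : (weilMarkovConstant a + weilOddGroundEnergy a) * ∫ x, ‖(χ x : ℂ) * u x‖ ^ 2 =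
      (weilMarkovConstant a + weilOddGroundEnergy a) * ((∫ x, ‖u x‖ ^ 2) +
        (∫ x, ‖((1 - χ x : ℝ) : ℂ) * u x‖ ^ 2) -
        2 * (∫ x, u x * conj (((1 - χ x : ℝ) : ℂ) * u x)).re) := by
    rw [F5']
  rw [hinner] at F8
  -- IMS: prime part, archimedean part, pole part
  have F9a : (∑ n ∈ weilPrimeIndex a, (Λ n : ℝ) / Real.sqrt n *
        weilIncrement (fun x ↦ ((1 - χ x : ℝ) : ℂ) * u x) (Real.log n)) -
      (∑ n ∈ weilPrimeIndex a, (Λ n : ℝ) / Real.sqrt n *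
        (∫ x, (u (x + Real.log n) - u x) * conj ((((1 - χ (x + Real.log n)) ^ 2 : ℝ) : ℂ) *
          u (x + Real.log n) - (((1 - χ x) ^ 2 : ℝ) : ℂ) * u x)).re) ≤
      ∑ n ∈ weilPrimeIndex a, (Λ n : ℝ) / Real.sqrt n *
        ∫ x, (χ (x + Real.log n) - χ x) ^ 2 * (‖u (x + Real.log n)‖ * ‖u x‖) := by
    rw [← Finset.sum_sub_distrib]
    refine Finset.sum_le_sum fun n _ ↦ ?_
    rw [← mul_sub]
    exact mul_le_mul_of_nonneg_left (stub_localizedCut_ims_increment hu hχc h01 (Real.log n))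
      (div_nonneg ArithmeticFunction.vonMangoldt_nonneg (Real.sqrt_nonneg _))
  have F9b : (∫ t in Ioi (0 : ℝ), weilArchDensity t *
        weilIncrement (fun x ↦ ((1 - χ x : ℝ) : ℂ) * u x) t) -
      (∫ t in Ioi (0 : ℝ), (weilArchDensity t : ℂ) *
        ∫ x, (u (x + t) - u x) * conj ((((1 - χ (x + t)) ^ 2 : ℝ) : ℂ) * u (x + t) -
          (((1 - χ x) ^ 2 : ℝ) : ℂ) * u x)).re ≤
      ∫ t in Ioi (0 : ℝ), weilArchDensity t *
        ∫ x, (χ (x + t) - χ x) ^ 2 * (‖u (x + t)‖ * ‖u x‖) := by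
    have hpol := stub_localizedCut_integrableOn_polar hu hθ2m hfinU hfinθ2
    have hconv := stub_localizedCut_re_setIntegral hpol
    beta_reduce at hconv
    rw [hconv]
    have hre : IntegrableOn (fun t ↦ weilArchDensity t *
        (∫ x, (u (x + t) - u x) * conj ((((1 - χ (x + t)) ^ 2 : ℝ) : ℂ) * u (x + t) -
          (((1 - χ x) ^ 2 : ℝ) : ℂ) * u x)).re) (Ioi 0) :=
      (stub_localizedCut_integrable_re hpol).congr (ae_of_all _ fun t ↦ by
        simp only [Complex.re_ofReal_mul])
    rw [← integral_sub hfinθ hre]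
    refine integral_mono_ae (hfinθ.sub hre)
      (stub_localizedCut_integrableOn_comm hu hχc h01 hK hχL) ?_
    refine (ae_restrict_iff' measurableSet_Ioi).2 (ae_of_all _ fun t (ht : 0 < t) ↦ ?_)
    beta_reduce
    rw [← mul_sub]
    exact mul_le_mul_of_nonneg_left (stub_localizedCut_ims_increment hu hχc h01 t)
      (weilArchDensity_pos ht).le
  have F9 : weilDirichletEnergy a (fun x ↦ ((1 - χ x : ℝ) : ℂ) * u x) =
      (∑ n ∈ weilPrimeIndex a, (Λ n : ℝ) / Real.sqrt n *
        weilIncrement (fun x ↦ ((1 - χ x : ℝ) : ℂ) * u x) (Real.log n)) +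
      ∫ t in Ioi (0 : ℝ), weilArchDensity t *
        weilIncrement (fun x ↦ ((1 - χ x : ℝ) : ℂ) * u x) t := rfl
  have F10a := Complex.abs_re_le_norm (2 * (∫ x, u x * (Real.cosh (x / 2) : ℂ)) *
    conj (∫ x, (((1 - χ x) ^ 2 : ℝ) : ℂ) * u x * (Real.cosh (x / 2) : ℂ)))
  have F10b := Complex.abs_re_le_norm (2 * (∫ x, u x * (Real.sinh (x / 2) : ℂ)) *
    conj (∫ x, (((1 - χ x) ^ 2 : ℝ) : ℂ) * u x * (Real.sinh (x / 2) : ℂ)))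
  rw [norm_mul, norm_mul, Complex.norm_conj, Complex.norm_two, abs_le] at F10a F10b
  have F10c : weilPoleForm (fun x ↦ ((1 - χ x : ℝ) : ℂ) * u x) =
      2 * ‖∫ t, ((1 - χ t : ℝ) : ℂ) * u t * (Real.cosh (t / 2) : ℂ)‖ ^ 2 -
        2 * ‖∫ t, ((1 - χ t : ℝ) : ℂ) * u t * (Real.sinh (t / 2) : ℂ)‖ ^ 2 := rfl
  have F10d := sq_nonneg ‖∫ t, ((1 - χ t : ℝ) : ℂ) * u t * (Real.sinh (t / 2) : ℂ)‖
  -- assemble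
  linarith [F1, F2, F3, F4, F5', F5m, F6, F7, F8, F9a, F9b, F9, F10a.1, F10a.2, F10b.1,
    F10b.2, F10c, F10d]

end Summit.RiemannHypothesis.RiemannHypothesis.Theorems.OddSectorWindowLipschitz

end
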